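import Summits.QuantumFields.BalabanUV.Beta.GAN24.SourceSideRatePhi

/-!
# `BalabanUV.Beta.GAN24.SourceSideRatePhiSum` — binder row G-an2-4 / (CONV-C), road P1-fibre, sub-part **PART S** of gan24-p1's row
# **P1-L11** `FibreRate` (leaf-20-g7's division, CLAIMS l.3039; TAKE l.3074) — PART 6 (last): the TWO-LEVEL RATE of `S_φ` in units `N³`
# (`p`-UNIFORM), and the READING-SIDE feed sums as conjugates of the source-side ones (PART R needs no separate analysis)

NOT IN PRINT; OUR PROOF ATTEMPT.  HONEST FRAMING (cell contract, verbatim): «discharging `BetaPertH` makes Bałaban's UV stability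
UNCONDITIONAL — a real constructive-QFT result; it is NOT the continuum limit and NOT the Clay problem.»  HONEST DEPENDENCY (verbatim):
«continuum YM on T⁴ ⇐ BetaPertH ∧ nine spine estimates (0/9 proved); BetaPertH ⇐ (D1) ∧ (D4) ∧ CAP+tail; G-an2-4 gates asym, D1 and
NE2/3/4.»  [folklore] explicit real analysis + conjugation bookkeeping over typer row T00 `GAN24/AliasObjects` (§9 real-zone facts BY NAME);
0 cite, 0 wall binder, no `def … : Prop`; two displayed rate constants (`rPhiPole`, `rPhiBox`) as `def`s.  It discharges NOTHING of
(CONV-C)'s K-slot `GAN24.CombesThomas.ConvCK 3 Lc` by itself.  NOT `BetaPertH`, NOT continuum, NOT Clay.  Value = kernel bookkeeping toward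
the K-slot route P1 of binder row G-an2-4, NOT summit progress.

## What is proved
* §1 `norm_termPhi_tail_le` (labels of `boxZ N′ q ∖ boxZ N q`): `‖termPhi_{N′}(Q)‖ ≤ ((1 + Lc)/8)/N² · Π_i mP Lc z_i`;
* §2 **`srcPhi_rate`**: for `q ∈ [−π,π]^D ∖ {0}`, `p = ofRealVec q`, two steps `N = M·Lc ≤ N′ = M′·Lc`:
  `‖srcPhi N′ p (fhatF N′ M′ p l y′) 0 l′/N′³ − srcPhi N p (fhatF N M p l y′) 0 l′/N³‖ ≤ (rPhiPole + rPhiBox D Lc)/N²` — `p`-UNIFORM,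
  `rPhiPole = π²/48 + π⁴/48 + π⁶/768`, `rPhiBox D Lc = ((π²/48)(D·Lc² + (D+3)·Lc + 1) + (1 + Lc)/8)·(1 + 4Lc)^D`; with `N = Lc^{j+1}` this is
  `c·θ^j`, `θ = Lc⁻²` — the shape leaf-20-g7 asked for in CLAIMS l.3039 (unit `u(N) = N⁻³`);
* §2b the unit-`N⁻³` DIVISION FORMS of part 3's bounds (`norm_srcC_div_le`, `norm_srcPhi_div_le`) — the `B_X` shapes of l.3119;
* §2c the PLUG FORMS at a step `j` (`N = Lc^{j+1}`, `N′ = Lc^{j+2}`): `srcPhi_bound_step`, `srcC_bound_step`, `srcPhi_rate_step`,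
  `srcC_rate_step` — literally the `hBφ/hBc/hRφ/hRc` hypothesis shapes of leaf-20-g7's `FibreRateMF.mf_rate_of_source_data` (l.3415);
* §3 **PART R = conj PART S** at real `p` (`conj (p μ) = p μ`): the reading-side feed sums of the `ff`/`fm` legs (l.3039, written out in T00
  currency, no new definition) are `R_c(κ; x′) = −conj S_c(κ; x′)` (`readingC_eq`) and `R_φ(κ, l′; x′) = −conj S_φ(l′; κ, x′)` (`readingPhi_eq`),
  termwise over `reg N p` from `readW = conj(N^D·srcW)`, `χ̂ = conj S/N^D`, `∂♭ = conj ∂`, `L_m ∈ ℝ` (T00 §9 BY NAME) — so every bound / rate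
  of parts 3–6 transfers to the reading side with the same constants (`‖conj z‖ = ‖z‖`).

Unit `b2b-balaban-gan24-formalise-leaf-07` (G-an2-4 formalisation swarm, leaf prover 07, gen 6), 2026-08-20.
-/

noncomputable section

open Complex Finset
open scoped BigOperators Real ComplexConjugate

namespace Summit.QuantumFields.BalabanUV.Beta.GAN24.SourceSideRatePhiSum

open Literature.Probability.LatticeModels (TorusSite)
open Literature.MathematicalPhysics.QuantumFieldTheory.Balaban1983to89.B4Strip (ofRealVec)
open Literature.MathematicalPhysics.QuantumFieldTheory.King1986 (momSq momSq_nonneg)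
open FibreSymbols (dhat dflat lapSym)
open FibreBlockSolve (dot)
open CapacitanceScalarRate CapacitanceScalarRateTerm CapacitanceScalarRateBox CapacitanceScalarRateSum
open SourceSidePair SourceSideMajorant SourceSideDict SourceSideBound SourceSideRate SourceSideRatePhi
open AliasObjects

variable {D : ℕ}

/-! ## §1 Tail bound of the `S_φ` model -/

section Tail

variable {N M' N' Lc : ℕ} [NeZero N] [NeZero N'] [NeZero M'] [NeZero Lc]

/-- **TAIL BOUND OF THE `S_φ` MODEL**: at a label of `boxZ N′ q` OUTSIDE the level-`N` box (`|Q|² ≥ π²N²`),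
`‖termPhi_{N′}(Q)‖ ≤ ((1 + Lc)/8)/N² · Π_i mP Lc z_i`.  [folklore; our proof] -/
theorem norm_termPhi_tail_le (hN'M' : N' = M' * Lc) {q : Fin D → ℝ} (hq : ∀ i, |q i| ≤ π) (hq0 : q ≠ 0) (l' l : Fin D)
    (y' : Fin D → ℤ) {z : Fin D → ℤ} (hz' : z ∈ boxZ N' q) (hzN : z ∉ boxZ N q) :
    ‖termPhi N' M' Lc q l' l y' (qv q z)‖ ≤ (1 + (Lc : ℝ)) / 8 / (N : ℝ) ^ 2 * ∏ i, mP Lc (z i) := by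
  have hN : 0 < N := Nat.pos_of_ne_zero (NeZero.ne N)
  have hN' : 0 < N' := Nat.pos_of_ne_zero (NeZero.ne N')
  have hM' : 0 < M' := Nat.pos_of_ne_zero (NeZero.ne M')
  have hLc : 0 < Lc := Nat.pos_of_ne_zero (NeZero.ne Lc)
  have hLcr : (0 : ℝ) < Lc := by exact_mod_cast hLc
  have hNr : (1 : ℝ) ≤ N := by exact_mod_cast hN
  have hN'M'r : (N' : ℝ) = M' * Lc := by exact_mod_cast hN'M'
  have hπ := Real.pi_pos
  have hQ' : ∀ i, |qv q z i| ≤ π * N' := abs_qv_le_of_mem_boxZ hq hz'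
  obtain ⟨hS', hS'inv⟩ := symN_label_bounds hq hq0 hz'
  have hbig : (π * N) ^ 2 ≤ momSq (qv q z) := sq_le_momSq_of_not_mem_boxZ hq hzN
  have hmpos : 0 < momSq (qv q z) := lt_of_lt_of_le (by positivity) hbig
  have hP : ‖∏ i, pairP N' M' (qv q z i)‖ ≤ ∏ i, mP Lc (z i) := norm_prod_pairP_le hN' hM' hLc hN'M'r hq hQ'
  have hPm := prod_mP_nonneg Lc z
  have hPl : ‖pairP N' M' (qv q z l)‖ ≤ 1 := norm_pairP_le_one hN' hM' _
  have hE : ‖eM Lc (qv q z l)‖ ≤ 2 := norm_eM_le_two Lc _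
  have hd : ‖dhat (ofRealVec q) l'‖ ≤ 2 := by
    rw [SymbolTaylor.norm_dhat_ofRealVec]; have := Real.abs_sin_le_one (q l' / 2); linarith
  have hm : (momSq (qv q z))⁻¹ ≤ ((π * N) ^ 2)⁻¹ := inv_anti₀ (by positivity) hbig
  have hinv : (symN N' (qv q z))⁻¹ ≤ 1 / 4 / (N : ℝ) ^ 2 := by
    calc (symN N' (qv q z))⁻¹ ≤ π ^ 2 / 4 * ((π * N) ^ 2)⁻¹ := hS'inv.trans (mul_le_mul_of_nonneg_left hm (by positivity))
      _ = 1 / 4 / (N : ℝ) ^ 2 := by field_simp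
  have hinv2 : (symN N' (qv q z))⁻¹ ^ 2 ≤ (1 / 4 / (N : ℝ) ^ 2) ^ 2 := pow_le_pow_left₀ (inv_nonneg.2 hS'.le) hinv 2
  have hN4 : (1 / 4 / (N : ℝ) ^ 2) ^ 2 ≤ 1 / 16 / (N : ℝ) ^ 2 := by
    rw [show (1 / 4 / (N : ℝ) ^ 2) ^ 2 = 1 / 16 / (N : ℝ) ^ 2 * (1 / (N : ℝ) ^ 2) by field_simp; ring]
    apply mul_le_of_le_one_right (by positivity)
    rw [div_le_one (by positivity)]; exact one_le_pow₀ hNr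
  refine (norm_termPhi_le_parts q l' l y' hS').trans ?_
  calc ‖∏ i, pairP N' M' (qv q z i)‖ * (‖pairP N' M' (qv q z l)‖ * (symN N' (qv q z))⁻¹ / 2
        + (Lc : ℝ) * ‖dhat (ofRealVec q) l'‖ * ‖eM Lc (qv q z l)‖ * (symN N' (qv q z))⁻¹ ^ 2 / 2)
      ≤ (∏ i, mP Lc (z i)) * (1 * (1 / 4 / (N : ℝ) ^ 2) / 2 + (Lc : ℝ) * 2 * 2 * (1 / 16 / (N : ℝ) ^ 2) / 2) := by
        refine mul_le_mul hP (add_le_add ?_ ?_) (by positivity) hPm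
        · gcongr
        · gcongr; exact hinv2.trans hN4
    _ = (1 + (Lc : ℝ)) / 8 / (N : ℝ) ^ 2 * ∏ i, mP Lc (z i) := by ring

end Tail

/-! ## §2 The two-level rate of `S_φ` -/

/-- The zero-alias coefficient of the `S_φ` rate (`p`-uniform): `rPhiPole = π²/48 + π⁴/48 + π⁶/768`. -/
def rPhiPole : ℝ := π ^ 2 / 48 + π ^ 4 / 48 + π ^ 6 / 768

/-- The alias-box coefficient of the `S_φ` rate: `rPhiBox D Lc = ((π²/48)(D·Lc² + (D+3)·Lc + 1) + (1 + Lc)/8)·(1 + 4Lc)^D`. -/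
def rPhiBox (D Lc : ℕ) : ℝ := (π ^ 2 / 48 * (D * (Lc : ℝ) ^ 2 + (D + 3) * Lc + 1) + (1 + (Lc : ℝ)) / 8) * (1 + 4 * (Lc : ℝ)) ^ D

/-- [folklore] `0 ≤ rPhiPole`. -/
theorem rPhiPole_nonneg : 0 ≤ rPhiPole := by unfold rPhiPole; positivity

/-- [folklore] `0 ≤ rPhiBox D Lc`. -/
theorem rPhiBox_nonneg (D Lc : ℕ) : 0 ≤ rPhiBox D Lc := by unfold rPhiBox; positivity

section RatePhi

variable {N M N' M' Lc : ℕ} [NeZero N] [NeZero M] [NeZero N'] [NeZero M'] [NeZero Lc]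

/-- **TWO-LEVEL RATE OF `S_φ`** (Part B for the source-side sum `S_φ` of the closed-form fibre function; the shape leaf-20-g7 asked for in
CLAIMS l.3039, unit `u(N) = N⁻³`, `p`-UNIFORM).  For `q ∈ [−π,π]^D ∖ {0}`, `p = ofRealVec q`, two steps `N = M·Lc ≤ N′ = M′·Lc`:
`‖srcPhi N′ p (fhatF N′ M′ p l y′) 0 l′/N′³ − srcPhi N p (fhatF N M p l y′) 0 l′/N³‖ ≤ (rPhiPole + rPhiBox D Lc)/N²`.  [folklore; our proof] -/
theorem srcPhi_rate (hNM : N = M * Lc) (hN'M' : N' = M' * Lc) (hNN' : N ≤ N') {q : Fin D → ℝ} (hq : ∀ i, |q i| ≤ π)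
    (hq0 : q ≠ 0) (l' l : Fin D) (y' : Fin D → ℤ) :
    ‖srcPhi N' (ofRealVec q) (fhatF N' M' (ofRealVec q) l y') 0 l' / (N' : ℂ) ^ 3
        - srcPhi N (ofRealVec q) (fhatF N M (ofRealVec q) l y') 0 l' / (N : ℂ) ^ 3‖
      ≤ (rPhiPole + rPhiBox D Lc) / (N : ℝ) ^ 2 := by
  classical
  have hN : 0 < N := Nat.pos_of_ne_zero (NeZero.ne N)
  have hN' : 0 < N' := Nat.pos_of_ne_zero (NeZero.ne N')
  have hNc : (N : ℂ) ^ 3 ≠ 0 := pow_ne_zero 3 (by exact_mod_cast hN.ne')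
  have hN'c : (N' : ℂ) ^ 3 ≠ 0 := pow_ne_zero 3 (by exact_mod_cast hN'.ne')
  have hπ := Real.pi_pos
  have hsub := boxZ_subset hq hNN' (N := N) (N' := N')
  rw [srcPhi_fhatF_eq hN'M' hq hq0 l' l y', srcPhi_fhatF_eq hNM hq hq0 l' l y', mul_div_cancel_left₀ _ hN'c,
    mul_div_cancel_left₀ _ hNc, ← Finset.sum_sdiff hsub, add_sub_assoc, ← Finset.sum_sub_distrib]
  have htail : ‖∑ z ∈ boxZ N' q \ boxZ N q, termPhi N' M' Lc q l' l y' (qv q z)‖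
      ≤ (1 + (Lc : ℝ)) / 8 / (N : ℝ) ^ 2 * (1 + 4 * (Lc : ℝ)) ^ D := by
    calc ‖∑ z ∈ boxZ N' q \ boxZ N q, termPhi N' M' Lc q l' l y' (qv q z)‖
        ≤ ∑ z ∈ boxZ N' q \ boxZ N q, ‖termPhi N' M' Lc q l' l y' (qv q z)‖ := norm_sum_le _ _
      _ ≤ ∑ z ∈ boxZ N' q \ boxZ N q, (1 + (Lc : ℝ)) / 8 / (N : ℝ) ^ 2 * ∏ i, mP Lc (z i) :=
          Finset.sum_le_sum fun z hz => by
            obtain ⟨hz', hzN⟩ := Finset.mem_sdiff.1 hz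
            exact norm_termPhi_tail_le (N := N) hN'M' hq hq0 l' l y' hz' hzN
      _ ≤ ∑ z ∈ boxZ N' q, (1 + (Lc : ℝ)) / 8 / (N : ℝ) ^ 2 * ∏ i, mP Lc (z i) :=
          Finset.sum_le_sum_of_subset_of_nonneg Finset.sdiff_subset fun z _ _ => mul_nonneg (by positivity) (prod_mP_nonneg Lc z)
      _ = (1 + (Lc : ℝ)) / 8 / (N : ℝ) ^ 2 * ∑ z ∈ boxZ N' q, ∏ i, mP Lc (z i) := by rw [Finset.mul_sum]
      _ ≤ (1 + (Lc : ℝ)) / 8 / (N : ℝ) ^ 2 * (1 + 4 * (Lc : ℝ)) ^ D :=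
          mul_le_mul_of_nonneg_left (sum_boxZ_prod_mP_le Lc q) (by positivity)
  have hbox : ‖∑ z ∈ boxZ N q, (termPhi N' M' Lc q l' l y' (qv q z) - termPhi N M Lc q l' l y' (qv q z))‖
      ≤ (π ^ 2 / 48 + π ^ 4 / 48 + π ^ 6 / 768) / (N : ℝ) ^ 2
        + π ^ 2 / 48 * (D * (Lc : ℝ) ^ 2 + (D + 3) * Lc + 1) / (N : ℝ) ^ 2 * (1 + 4 * (Lc : ℝ)) ^ D := by
    calc ‖∑ z ∈ boxZ N q, (termPhi N' M' Lc q l' l y' (qv q z) - termPhi N M Lc q l' l y' (qv q z))‖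
        ≤ ∑ z ∈ boxZ N q, ‖termPhi N' M' Lc q l' l y' (qv q z) - termPhi N M Lc q l' l y' (qv q z)‖ := norm_sum_le _ _
      _ ≤ ∑ z ∈ boxZ N q, ((if z = 0 then (π ^ 2 / 48 + π ^ 4 / 48 + π ^ 6 / 768) / (N : ℝ) ^ 2 else 0)
            + π ^ 2 / 48 * (D * (Lc : ℝ) ^ 2 + (D + 3) * Lc + 1) / (N : ℝ) ^ 2 * ∏ i, mP Lc (z i)) :=
          Finset.sum_le_sum fun z hz => norm_termPhi_sub_le hNM hN'M' hNN' hq hq0 l' l y' hz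
      _ = (∑ z ∈ boxZ N q, (if z = 0 then (π ^ 2 / 48 + π ^ 4 / 48 + π ^ 6 / 768) / (N : ℝ) ^ 2 else 0))
            + π ^ 2 / 48 * (D * (Lc : ℝ) ^ 2 + (D + 3) * Lc + 1) / (N : ℝ) ^ 2 * ∑ z ∈ boxZ N q, ∏ i, mP Lc (z i) := by
          rw [Finset.sum_add_distrib, Finset.mul_sum]
      _ ≤ _ := add_le_add (sum_boxZ_ite_le q (by positivity))
            (mul_le_mul_of_nonneg_left (sum_boxZ_prod_mP_le Lc q) (by positivity))
  have e : (rPhiPole + rPhiBox D Lc) / (N : ℝ) ^ 2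
      = (1 + (Lc : ℝ)) / 8 / (N : ℝ) ^ 2 * (1 + 4 * (Lc : ℝ)) ^ D
        + ((π ^ 2 / 48 + π ^ 4 / 48 + π ^ 6 / 768) / (N : ℝ) ^ 2
          + π ^ 2 / 48 * (D * (Lc : ℝ) ^ 2 + (D + 3) * Lc + 1) / (N : ℝ) ^ 2 * (1 + 4 * (Lc : ℝ)) ^ D) := by
    unfold rPhiPole rPhiBox; field_simp; ring
  rw [e]
  exact (norm_add_le _ _).trans (add_le_add htail hbox)


/-- [folklore] **`S_c` BOUND IN UNIT `N⁻³`** (division form of part 3's `norm_srcC_fhatF_le`, the `B_X` shape of CLAIMS l.3119):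
`‖srcC N p (fhatF N M p l y′)/N³‖ ≤ (π⁴/16)/(|q|²·|q|) + (Lc/8)·(1 + 4Lc)^D`. -/
theorem norm_srcC_div_le (hNM : N = M * Lc) {q : Fin D → ℝ} (hq : ∀ i, |q i| ≤ π) (hq0 : q ≠ 0) (l : Fin D) (y' : Fin D → ℤ) :
    ‖srcC N (ofRealVec q) (fhatF N M (ofRealVec q) l y') / (N : ℂ) ^ 3‖
      ≤ π ^ 4 / 16 / (momSq q * Real.sqrt (momSq q)) + (Lc : ℝ) / 8 * (1 + 4 * (Lc : ℝ)) ^ D := by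
  have hN : 0 < N := Nat.pos_of_ne_zero (NeZero.ne N)
  have hN3 : (0 : ℝ) < (N : ℝ) ^ 3 := by positivity
  rw [norm_div, norm_pow, Complex.norm_natCast, div_le_iff₀ hN3]
  have h := norm_srcC_fhatF_le hNM hq hq0 l y'
  linarith

/-- [folklore] **`S_φ` BOUND IN UNIT `N⁻³`** (division form of part 3's `norm_srcPhi_fhatF_le`):
`‖srcPhi N p (fhatF N M p l y′) 0 l′/N³‖ ≤ (π²/8 + π⁴/32)/|q|² + ((1 + Lc)/8)·(1 + 4Lc)^D`. -/
theorem norm_srcPhi_div_le (hNM : N = M * Lc) {q : Fin D → ℝ} (hq : ∀ i, |q i| ≤ π) (hq0 : q ≠ 0) (l' l : Fin D) (y' : Fin D → ℤ) :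
    ‖srcPhi N (ofRealVec q) (fhatF N M (ofRealVec q) l y') 0 l' / (N : ℂ) ^ 3‖
      ≤ (π ^ 2 / 8 + π ^ 4 / 32) / momSq q + (1 + (Lc : ℝ)) / 8 * (1 + 4 * (Lc : ℝ)) ^ D := by
  have hN : 0 < N := Nat.pos_of_ne_zero (NeZero.ne N)
  have hN3 : (0 : ℝ) < (N : ℝ) ^ 3 := by positivity
  rw [norm_div, norm_pow, Complex.norm_natCast, div_le_iff₀ hN3]
  have h := norm_srcPhi_fhatF_le hNM hq hq0 l' l y'
  linarith


/-! ### §2c Plug forms at a step `j` (the literal `hBφ/hBc/hRφ/hRc` shapes of leaf-20-g7's `FibreRateMF.mf_rate_of_source_data`) -/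

section Step

variable {Lc : ℕ} [NeZero Lc]

/-- [folklore] The two consecutive steps `(N, M) = (Lc^{j+1}, Lc^j)`, `(N′, M′) = (Lc^{j+2}, Lc^{j+1})` satisfy the level hypotheses. -/
theorem step_hyps (j : ℕ) :
    Lc ^ (j + 1) = Lc ^ j * Lc ∧ Lc ^ (j + 2) = Lc ^ (j + 1) * Lc ∧ Lc ^ (j + 1) ≤ Lc ^ (j + 2) :=
  ⟨pow_succ Lc j, pow_succ Lc (j + 1),
    Nat.pow_le_pow_right (Nat.pos_of_ne_zero (NeZero.ne Lc)) (by omega)⟩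

/-- [folklore] `hBφ` shape: `‖(N′³)⁻¹ · srcPhi N′ p (fhatF N′ M′ p l y′) 0 l′‖ ≤ (π²/8 + π⁴/32)/|q|² + ((1 + Lc)/8)(1 + 4Lc)^D` at `N′ = Lc^{j+2}`, `M′ = Lc^{j+1}`. -/
theorem srcPhi_bound_step (j : ℕ) {q : Fin D → ℝ} (hq : ∀ i, |q i| ≤ π) (hq0 : q ≠ 0) (l : Fin D) (y' : Fin D → ℤ) (l' : Fin D) :
    ‖((((Lc ^ (j + 2) : ℕ) : ℂ) ^ 3)⁻¹) *
        srcPhi (Lc ^ (j + 2)) (ofRealVec q) (fhatF (Lc ^ (j + 2)) (Lc ^ (j + 1)) (ofRealVec q) l y') 0 l'‖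
      ≤ (π ^ 2 / 8 + π ^ 4 / 32) / momSq q + (1 + (Lc : ℝ)) / 8 * (1 + 4 * (Lc : ℝ)) ^ D := by
  obtain ⟨-, h2, -⟩ := step_hyps (Lc := Lc) j
  rw [inv_mul_eq_div]
  exact norm_srcPhi_div_le h2 hq hq0 l' l y'

/-- [folklore] `hBc` shape: `‖(N′³)⁻¹ · srcC N′ p (fhatF N′ M′ p l y′)‖ ≤ (π⁴/16)/(|q|²·|q|) + (Lc/8)(1 + 4Lc)^D` at `N′ = Lc^{j+2}`. -/
theorem srcC_bound_step (j : ℕ) {q : Fin D → ℝ} (hq : ∀ i, |q i| ≤ π) (hq0 : q ≠ 0) (l : Fin D) (y' : Fin D → ℤ) :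
    ‖((((Lc ^ (j + 2) : ℕ) : ℂ) ^ 3)⁻¹) * srcC (Lc ^ (j + 2)) (ofRealVec q) (fhatF (Lc ^ (j + 2)) (Lc ^ (j + 1)) (ofRealVec q) l y')‖
      ≤ π ^ 4 / 16 / (momSq q * Real.sqrt (momSq q)) + (Lc : ℝ) / 8 * (1 + 4 * (Lc : ℝ)) ^ D := by
  obtain ⟨-, h2, -⟩ := step_hyps (Lc := Lc) j
  rw [inv_mul_eq_div]
  exact norm_srcC_div_le h2 hq hq0 l y'

/-- [folklore] `hRφ` shape: the `S_φ` one-step rate with denominator `(Lc^{j+1})²` — `p`-uniform numerator `rPhiPole + rPhiBox D Lc`. -/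
theorem srcPhi_rate_step (j : ℕ) {q : Fin D → ℝ} (hq : ∀ i, |q i| ≤ π) (hq0 : q ≠ 0) (l : Fin D) (y' : Fin D → ℤ) (l' : Fin D) :
    ‖((((Lc ^ (j + 2) : ℕ) : ℂ) ^ 3)⁻¹) *
          srcPhi (Lc ^ (j + 2)) (ofRealVec q) (fhatF (Lc ^ (j + 2)) (Lc ^ (j + 1)) (ofRealVec q) l y') 0 l'
        - ((((Lc ^ (j + 1) : ℕ) : ℂ) ^ 3)⁻¹) *
          srcPhi (Lc ^ (j + 1)) (ofRealVec q) (fhatF (Lc ^ (j + 1)) (Lc ^ j) (ofRealVec q) l y') 0 l'‖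
      ≤ (rPhiPole + rPhiBox D Lc) / (((Lc ^ (j + 1) : ℕ) : ℝ)) ^ 2 := by
  obtain ⟨h1, h2, h3⟩ := step_hyps (Lc := Lc) j
  rw [inv_mul_eq_div, inv_mul_eq_div]
  exact srcPhi_rate h1 h2 h3 hq hq0 l' l y'

/-- [folklore] `hRc` shape: the `S_c` one-step rate with denominator `(Lc^{j+1})²` — numerator `rcPole/|q| + rcBox D Lc`. -/
theorem srcC_rate_step (j : ℕ) {q : Fin D → ℝ} (hq : ∀ i, |q i| ≤ π) (hq0 : q ≠ 0) (l : Fin D) (y' : Fin D → ℤ) :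
    ‖((((Lc ^ (j + 2) : ℕ) : ℂ) ^ 3)⁻¹) * srcC (Lc ^ (j + 2)) (ofRealVec q) (fhatF (Lc ^ (j + 2)) (Lc ^ (j + 1)) (ofRealVec q) l y')
        - ((((Lc ^ (j + 1) : ℕ) : ℂ) ^ 3)⁻¹) * srcC (Lc ^ (j + 1)) (ofRealVec q) (fhatF (Lc ^ (j + 1)) (Lc ^ j) (ofRealVec q) l y')‖
      ≤ (rcPole / Real.sqrt (momSq q) + rcBox D Lc) / (((Lc ^ (j + 1) : ℕ) : ℝ)) ^ 2 := by
  obtain ⟨h1, h2, h3⟩ := step_hyps (Lc := Lc) j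
  rw [inv_mul_eq_div, inv_mul_eq_div]
  exact srcC_rate h1 h2 h3 hq hq0 l y'

end Step

end RatePhi

/-! ## §3 PART R: the reading-side feed sums are conjugates of the source-side sums (real momentum) -/

section Reading

variable {N M : ℕ} [NeZero N] {p : Fin D → ℂ}

/-- **`R_c = −conj S_c`**: at a real momentum, the reading-side feed sum of the gauge channel (CLAIMS l.3039,
`R_c(κ; x′) = Σ_{m ∈ reg} readW(m,κ,x′)·χ̂_m·∂_{mκ}/L_m²`) is minus the conjugate of `srcC N p (fhatF N M p κ x′)`.  [folklore] -/
theorem readingC_eq (hp : ∀ μ, conj (p μ) = p μ) (κ : Fin D) (x' : Fin D → ℤ) :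
    ∑ m ∈ reg N p, readW N M p m κ x' * chiAl N p m * dAl N p m κ / LAl N p m ^ 2
      = -conj (srcC N p (fhatF N M p κ x')) := by
  have hNc : (N : ℂ) ≠ 0 := by exact_mod_cast NeZero.ne N
  rw [srcC, map_neg, neg_neg, map_sum]
  refine Finset.sum_congr rfl fun m _ => ?_
  have hS : conj (SAl N p m) = (N : ℂ) ^ D * chiAl N p m := by
    rw [chiAl, SbAl_eq_conj hp]; field_simp
  have hd : conj (dbAl N p m κ) = dAl N p m κ := by rw [dbAl_eq_conj hp, Complex.conj_conj]
  have hw : conj (srcW N M p m κ x') = readW N M p m κ x' / (N : ℂ) ^ D := by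
    rw [srcW_eq_conj hp, map_div₀, Complex.conj_conj, map_pow, map_natCast]
  have hL : conj (LAl N p m) = LAl N p m := by rw [LAl_eq_sum_normSq hp, Complex.conj_ofReal]
  rw [dot_fhatF, map_div₀, map_mul, map_mul, map_pow, hS, hd, hw, hL]
  field_simp

/-- **`R_φ = −conj S_φᵀ`**: at a real momentum, the reading-side feed sum of the multiplier channel (CLAIMS l.3039,
`R_φ(κ, l′; x′) = Σ_{m ∈ reg} readW(m,κ,x′)·χ̂_m·(δ_{κl′} − ∂_{mκ}∂♭_{ml′}/L_m)·s♭_{l′}(m)/(2L_m)`) is minus the conjugate of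
`srcPhi N p (fhatF N M p κ x′) 0 l′`.  [folklore] -/
theorem readingPhi_eq (hp : ∀ μ, conj (p μ) = p μ) (κ l' : Fin D) (x' : Fin D → ℤ) :
    ∑ m ∈ reg N p, readW N M p m κ x' * chiAl N p m *
        ((if κ = l' then 1 else 0) - dAl N p m κ * dbAl N p m l' / LAl N p m) * sbAl N p m l' / (2 * LAl N p m)
      = -conj (srcPhi N p (fhatF N M p κ x') 0 l') := by
  have hNc : (N : ℂ) ≠ 0 := by exact_mod_cast NeZero.ne N
  rw [srcPhi, Pi.zero_apply, zero_sub, map_neg, neg_neg, map_sum]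
  refine Finset.sum_congr rfl fun m hm => ?_
  have hLm : LAl N p m ≠ 0 := (mem_reg N p m).1 hm
  have hS : conj (SAl N p m) = (N : ℂ) ^ D * chiAl N p m := by
    rw [chiAl, SbAl_eq_conj hp]; field_simp
  have hs : conj (sAl N p m l') = sbAl N p m l' := by rw [sbAl_eq_conj hp]
  have hdl : conj (dAl N p m l') = dbAl N p m l' := by rw [dbAl_eq_conj hp]
  have hdκ : conj (dbAl N p m κ) = dAl N p m κ := by rw [dbAl_eq_conj hp, Complex.conj_conj]
  have hw : conj (srcW N M p m κ x') = readW N M p m κ x' / (N : ℂ) ^ D := by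
    rw [srcW_eq_conj hp, map_div₀, Complex.conj_conj, map_pow, map_natCast]
  have hL : conj (LAl N p m) = LAl N p m := by rw [LAl_eq_sum_normSq hp, Complex.conj_ofReal]
  have hpi : piPerp (dAl N p m) (dbAl N p m) (LAl N p m) (fhatF N M p κ x' m) l'
      = srcW N M p m κ x' * ((if κ = l' then 1 else 0) - dAl N p m l' * dbAl N p m κ / LAl N p m) := by
    unfold piPerp
    rw [dot_fhatF]
    unfold fhatF
    by_cases h : κ = l'
    · subst h; simp only [if_true]; ring
    · rw [if_neg (Ne.symm h), if_neg h]; ring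
  rw [hpi, map_mul, map_mul, map_mul, map_div₀, map_mul, map_sub, map_div₀, map_mul, hS, hs, hw, hL, hdl, hdκ, map_ofNat]
  have hδ : conj ((if κ = l' then 1 else 0 : ℂ)) = (if κ = l' then 1 else 0 : ℂ) := by split_ifs <;> simp
  rw [hδ]
  field_simp

end Reading

end Summit.QuantumFields.BalabanUV.Beta.GAN24.SourceSideRatePhiSum

end
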